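import Mathlib.Data.Nat.Choose.Vandermonde
import Mathlib.Data.Finset.Powerset
import Mathlib.Data.Fintype.Powerset
import Mathlib.Algebra.BigOperators.Fin
import HarnessLib

/-!
# Landsberg–Ressayre, Thm. 2.1 — the count `Σ_{s=1}^{m-1} C(m,s)² = C(2m,m) - 2`

Topic `Literature/Computability/AlgebraicComplexity`.  The elementary count at the end of the
proof of LR17 Thm. 2.1 (`edc(perm_m) ≥ C(2m, m) - 1`): the weight spaces found inside `range Λ`
are indexed by the pairs `(R, T)` of subsets of `[m]` with `|R| = |T| = s`, `1 ≤ s ≤ m - 1`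
(LR17 §2.3/§6: `ℂⁿ ⊇ ⊕_{k=1}^{m-1} (S^k E)_{reg} ⊗ (S^k F^*)_{reg}`, of dimension `Σ C(m,k)²`), and
together with the top weight this gives `n ≥ Σ_{s=0}^{m-1} C(m,s)² = C(2m,m) - 1` by Vandermonde's
identity (Mathlib `Nat.sum_range_choose_sq`).  Here, as finset cardinalities:

* `card_filter_card_eq_card`: `#{(R, T) : |R| = |T|} = C(2m, m)`;
* `card_filter_card_eq_card_proper`: `#{(R, T) : |R| = |T|, R ≠ ∅, R ≠ [m]} = C(2m, m) - 2` (`m ≥ 1`).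

## References

* J. M. Landsberg, N. Ressayre, *Permanent v. determinant: an exponential lower bound assuming
  symmetry and a potential path towards Valiant's conjecture*, Differential Geom. Appl. 55 (2017)
  146–166, arXiv:1508.05788: Thm. 2.1, Prop. 2.10 (`n = C(2m,m) - 1`), §6.
-/

namespace Literature.Computability.AlgebraicComplexity

namespace LR21

open Finset

variable {m : ℕ}

/-- `#{R ⊆ [m] : |R| = s} = C(m, s)`. [folklore] -/
theorem card_filter_card_eq (m s : ℕ) :
    (univ.filter fun R : Finset (Fin m) => R.card = s).card = m.choose s := by
  have h : (univ.filter fun R : Finset (Fin m) => R.card = s) = powersetCard s univ := by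
    rw [powersetCard_eq_filter, powerset_univ]
  rw [h, card_powersetCard, card_univ, Fintype.card_fin]

/-- **`#{(R, T) : R, T ⊆ [m], |R| = |T|} = C(2m, m)`** (sum over `s = |R|` of `C(m,s)²` and
Vandermonde, LR17 §2.3: `Σ_k dim (S^kE)_{reg} ⊗ (S^kF^*)_{reg} = C(2m,m)`). [cite: LandsbergRessayre2017, Prop. 2.10] -/
theorem card_filter_card_eq_card (m : ℕ) :
    (univ.filter fun RT : Finset (Fin m) × Finset (Fin m) => RT.1.card = RT.2.card).card =
      (2 * m).choose m := by
  rw [← Nat.sum_range_choose_sq m]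
  rw [card_eq_sum_card_fiberwise (f := fun RT : Finset (Fin m) × Finset (Fin m) => RT.1.card)
    (t := range (m + 1)) (fun RT _ => mem_range_succ_iff.2 (card_finset_fin_le RT.1))]
  refine sum_congr rfl fun s _ => ?_
  have hfib : ((univ.filter fun RT : Finset (Fin m) × Finset (Fin m) => RT.1.card = RT.2.card).filter
      fun RT => RT.1.card = s) =
      (univ.filter fun R : Finset (Fin m) => R.card = s) ×ˢ (univ.filter fun T : Finset (Fin m) => T.card = s) := by
    ext ⟨R, T⟩
    simp only [mem_filter, mem_univ, true_and, mem_product]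
    omega
  rw [hfib, card_product, card_filter_card_eq, sq]

/-- **`#{(R, T) : |R| = |T|, R ≠ ∅, R ≠ [m]} = C(2m, m) - 2`** for `m ≥ 1`: remove the pairs
`(∅, ∅)` and `([m], [m])` (the weight of `ker Λ` and the top weight are counted separately in
LR17 §6). [cite: LandsbergRessayre2017, Thm. 2.1] -/
theorem card_filter_card_eq_card_proper (hm : 1 ≤ m) :
    (univ.filter fun RT : Finset (Fin m) × Finset (Fin m) =>
        RT.1.card = RT.2.card ∧ RT.1 ≠ ∅ ∧ RT.1 ≠ univ).card = (2 * m).choose m - 2 := by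
  classical
  have hne : ((∅, ∅) : Finset (Fin m) × Finset (Fin m)) ≠ (univ, univ) := by
    intro h
    have h1 : (∅ : Finset (Fin m)) = univ := congrArg Prod.fst h
    have : (univ : Finset (Fin m)).card = 0 := by rw [← h1]; rfl
    rw [card_univ, Fintype.card_fin] at this
    omega
  have hset : (univ.filter fun RT : Finset (Fin m) × Finset (Fin m) =>
        RT.1.card = RT.2.card ∧ RT.1 ≠ ∅ ∧ RT.1 ≠ univ) =
      (univ.filter fun RT : Finset (Fin m) × Finset (Fin m) => RT.1.card = RT.2.card) \
        {((∅, ∅) : Finset (Fin m) × Finset (Fin m)), (univ, univ)} := by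
    ext ⟨R, T⟩
    simp only [mem_filter, mem_univ, true_and, mem_sdiff, mem_insert, mem_singleton, Prod.mk.injEq,
      not_or, not_and]
    constructor
    · rintro ⟨h1, h2, h3⟩
      exact ⟨h1, fun h => absurd h h2, fun h => absurd h h3⟩
    · rintro ⟨h1, h2, h3⟩
      refine ⟨h1, fun hR => h2 hR ?_, fun hR => h3 hR ?_⟩
      · rw [hR, card_empty] at h1
        exact card_eq_zero.1 h1.symm
      · rw [hR, card_univ, Fintype.card_fin] at h1
        exact (card_eq_iff_eq_univ T).1 (by rw [← h1, Fintype.card_fin])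
  rw [hset, card_sdiff_of_subset, card_filter_card_eq_card, card_pair hne]
  intro x hx
  simp only [mem_insert, mem_singleton] at hx
  rcases hx with rfl | rfl <;> simp

end LR21

end Literature.Computability.AlgebraicComplexity
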